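import Summits.CriticalPhenomena.PercolationContinuityZ3.Theses.PercLowPointHalfSpace

/-!
# Sketch — crux idea `staple-census-exact-height` for `BoundaryTwoArmDecay` (stmt-CriticalPhenomena-0911)

Lever: translate the adjacent-root kiss over all LEVELS `l` (vertical stationarity of the family of
half-spaces `{x₀ ≥ l}` under the product measure), open a 3-edge STAPLE under a level-`1` kiss
(independent, factor `p_c⁻³`) so that the kiss becomes a MERGER between consecutive levels in the
genealogy of tall footed half-space components, and use the stationary census identity
`E[mergers] + E[sealed] = E[births] = ν_n − ν_{n+1}` (births = components of height EXACTLY `n`).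
Output: `P(kissV n) ≤ (m₀/p_c³)·e_n` with `e_n := E[1{height(U)=n}/|U ∩ ∂ℍ|]`, `Σ_n e_n ≤ 1`.
No arm exponent, no BK. Everything below elaborates; nothing is proved here (crux-ideate stage).
-/

noncomputable section

namespace Summit.CriticalPhenomena.PercolationContinuityZ3.Cruxes.BoundaryTwoArmDecay.StapleCensus

open MeasureTheory Literature.Probability.LatticeModels Literature.Probability.Percolation

/-- Critical bond percolation on `ℤ³`. -/
abbrev P : Measure (BondConfig (Site 3)) := bondPercolation (zdGraph 3) (criticalProbI 3)

/-- `p_c(ℤ³)` as a real number. -/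
abbrev pc : ℝ := ((criticalProbI 3 : unitInterval) : ℝ)

/-- Floor direction `e = (0,1,0)` (the crux's `Pi.single 1 1`) and normal `e₀ = (1,0,0)`. -/
abbrev e : Site 3 := Pi.single 1 1

/-- Normal direction. -/
abbrev e₀ : Site 3 := Pi.single 0 1

/-- The half-space above level `l`. `up 0` is the crux's `{x | 0 ≤ x 0}`. -/
def up (l : ℤ) : Set (Site 3) := {x | l ≤ x 0}

/-- The level-`l` component of `x` (open cluster of `x` inside `{x₀ ≥ l}`) reaches height `l + n`. -/
def heightGE (l : ℤ) (x : Site 3) (n : ℕ) : Set (BondConfig (Site 3)) :=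
  {ω | ∃ y : Site 3, l + (n : ℤ) ≤ y 0 ∧ ω ∈ openConnIn (up l) x y}

/-- VERTICAL-REACH KISS at level `l`, rooted at `x` (with `x₀ = l`), direction `e`:
the level-`l` components of `x` and `x + e` are distinct and both reach height `l + n`. -/
def kissV (l : ℤ) (x : Site 3) (n : ℕ) : Set (BondConfig (Site 3)) :=
  heightGE l x n ∩ heightGE l (x + e) n ∩ (openConnIn (up l) x (x + e))ᶜ

/-- The crux's own event (sup-norm reach `≥ n` from each root), transcribed from the route decl. -/
def kissSup (n : ℕ) : Set (BondConfig (Site 3)) :=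
  {ω | (∃ y : Site 3, (∃ i : Fin 3, (n : ℤ) ≤ |y i|) ∧ ω ∈ openConnIn (up 0) 0 y) ∧
       (∃ y : Site 3, (∃ i : Fin 3, (n : ℤ) ≤ |y i - e i|) ∧ ω ∈ openConnIn (up 0) e y) ∧
       ω ∉ openConnIn (up 0) 0 e}

/-- The three STAPLE edges under the level-`1` pair `(e₀, e₀ + e)`: `{0,e₀}`, `{0,e}`, `{e,e+e₀}`.
They lie outside `{x₀ ≥ 1}`, hence are independent of every level-`1` event. -/
def stapleOpen : Set (BondConfig (Site 3)) :=
  {ω | s((0 : Site 3), e₀) ∈ ω ∧ s((0 : Site 3), e) ∈ ω ∧ s(e, e + e₀) ∈ ω}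

/-- FIRST LEMMA (a) — staple independence (provable now from `bondPercolation` = product measure):
`P(kiss¹ₙ ∩ staple open) = p_c³ · P(kiss¹ₙ)`. -/
def StapleIndependence : Prop :=
  ∀ n : ℕ, P.real (kissV 1 e₀ n ∩ stapleOpen) = pc ^ 3 * P.real (kissV 1 e₀ n)

/-- FIRST LEMMA (b) — vertical (and horizontal) stationarity of the half-space family: the kiss
probability at level `l` rooted at any `x` with `x₀ = l` equals the level-`0` kiss probability at `0`
(the law of `ω ∩ E({x₀ ≥ l})`, shifted, is the law of `ω ∩ E(ℍ)`). -/
def VerticalStationarity : Prop :=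
  ∀ n : ℕ, ∀ l : ℤ, ∀ x : Site 3, x 0 = l → P.real (kissV l x n) = P.real (kissV 0 0 n)

/-- FIRST LEMMA (c) — a stapled kiss is a merger: the two (distinct, tall) level-`1` components of
`e₀` and `e₀ + e` lie in ONE level-`0` component. Deterministic. -/
def KissStapleMerges : Prop :=
  ∀ n : ℕ, ∀ ω : BondConfig (Site 3), ω ∈ kissV 1 e₀ n ∩ stapleOpen →
    ω ∈ openConnIn (up 0) e₀ (e₀ + e) ∧ ω ∉ openConnIn (up 1) e₀ (e₀ + e)

/-- `ν_n := E[ 1{U reaches height n} / |U ∩ ∂ℍ| ]` — by horizontal mass transport the per-site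
density of lex-rooted half-space clusters of height `≥ n` (`= T_n / n²`). -/
def nuDens (n : ℕ) : ENNReal :=
  ∫⁻ ω, (heightGE 0 0 n).indicator (fun ω => ((halfSpaceFootprint ω : ℕ∞) : ENNReal)⁻¹) ω ∂P

/-- `e_n := E[ 1{height(U) = n} / |U ∩ ∂ℍ| ] = ν_n − ν_{n+1}` — exact-height (birth) density. -/
def eDens (n : ℕ) : ENNReal :=
  ∫⁻ ω, (heightGE 0 0 n \ heightGE 0 0 (n + 1)).indicator
    (fun ω => ((halfSpaceFootprint ω : ℕ∞) : ENNReal)⁻¹) ω ∂P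

/-- Exact-height densities are summable with total mass `≤ 1` (each a.s.-finite `U` has one height;
BGN finiteness `BarskyGrimmettNewman1991_Z3_holds` makes `ν_n = Σ_{k ≥ n} e_k`). Provable now. -/
def ExactHeightSummable : Prop :=
  (∑' n : ℕ, eDens n) ≤ 1 ∧ ∀ n : ℕ, nuDens n = ∑' k : ℕ, eDens (n + k)

/-- THE CENSUS BOUND — output of the lever given a kiss-multiplicity profile `m₀`:
`P(kissV⁰ₙ) ≤ (m₀(n)/p_c³) · e_n`. (Census identity `E M + E S = E B`, `M ≥ p_c³·kisses/m₀`.) -/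
def CensusBound (m₀ : ℕ → ℝ) : Prop :=
  ∀ n : ℕ, 1 ≤ n → P.real (kissV 0 0 n) ≤ m₀ n / pc ^ 3 * (eDens n).toReal

/-- RESIDUAL 1 (rate-form half-space non-proliferation): lex-rooted tall clusters have density
`≤ n^{-(3/2+κ)}`, i.e. `T_n ≤ C n^{1/2-κ}` tall half-space clusters per `n × n` floor patch. -/
def LexRootedTallDensity (κ : ℝ) : Prop :=
  ∃ C : ℝ, ∀ n : ℕ, 1 ≤ n → (nuDens n).toReal ≤ C * (n : ℝ) ^ (-(3 / 2 + κ))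

/-- RESIDUAL 2 (sup-norm reach to vertical reach, up to an admissible error). -/
def ReachReduction (κ : ℝ) : Prop :=
  ∃ C c : ℝ, 0 < c ∧ ∀ n : ℕ, 1 ≤ n →
    P.real (kissSup n) ≤ C * P.real (kissV 0 0 ⌈c * n⌉₊) + C * (n : ℝ) ^ (-(5 / 2 + κ))

/-- What the line asserts: census bound + `n^{κ/2}` multiplicity + the two residuals give the crux
(averaging `e_k` over `k ∈ [n,2n]` using monotonicity of `kissV` in `n`: `P(kissV_{2n}) ≤ C m₀ ν_n / n`). -/
def LineCloses : Prop :=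
  ∀ κ : ℝ, 0 < κ → ∀ m₀ : ℕ → ℝ,
    (∃ C : ℝ, ∀ n : ℕ, 1 ≤ n → m₀ n ≤ C * (n : ℝ) ^ (κ / 2)) →
    CensusBound m₀ → LexRootedTallDensity κ → ReachReduction κ →
      Summit.CriticalPhenomena.PercolationContinuityZ3.Theses.PercLowPointHalfSpace.BoundaryTwoArmDecay

/-- Unconditional by-product of the lever (modulo multiplicity): `Σ_n P(kissV n)/m₀(n) < ∞`, hence with
`kissV` monotone and `m₀ = O(n^{o(1)})` the VERTICAL boundary two-arm exponent is `≥ 1` — already out of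
reach of BK + any proved one-arm rate. With `QuantitativeBGN` (exponent `a`) it is `≥ 1 + a`. -/
def VerticalTwoArmAtLeastOne : Prop :=
  ∀ ε : ℝ, 0 < ε → ∃ C : ℝ, ∀ n : ℕ, 1 ≤ n → P.real (kissV 0 0 n) ≤ C * (n : ℝ) ^ (-(1 - ε))

end Summit.CriticalPhenomena.PercolationContinuityZ3.Cruxes.BoundaryTwoArmDecay.StapleCensus

end
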